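import Summits.RiemannHypothesis.RiemannHypothesis.Theses.RuelleBand
import Summits.RiemannHypothesis.RiemannHypothesis.Theorems.RuelleBandZetaWeakRecurrenceStubRecurrenceOfApproximant
import Summits.RiemannHypothesis.RiemannHypothesis.Theorems.RuelleBandZetaWeakRecurrenceStubApproximantOfNoInteriorZero
import Summits.RiemannHypothesis.RiemannHypothesis.Theorems.RuelleBandNribWeakRecurrenceToExact
import Summits.RiemannHypothesis.RiemannHypothesis.Theorems.RuelleBandLadderGlue
import Summits.RiemannHypothesis.RiemannHypothesis.Theorems.RuelleBandAsymptoticCriticalLineSplit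
import Literature.Barriers.RiemannHypothesis.BohrDenseValuesProofs

/-!
# `RuelleBand.ZetaWeakRecurrence` — the Rouché regime: lossless reshape and tightness
(crux stmt-RiemannHypothesis-18110, line `Sketch`, route route-RiemannHypothesis-RuelleBand)

WR (`ZetaWeakRecurrence`): on every closed disc `|s − z| ≤ r` of the half-strip `1/2 < σ < 1`, for
every `ε > 0` and every height `T`, some shift `τ ≥ T` has `max_{|s−z|≤r} |ζ(s+iτ) − ζ(s)| < ε`.

The line's registered skeleton (`Cruxes/ZetaWeakRecurrence/Lines/Sketch.lean`) splits WR into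
* the APPROXIMABLE regime — `ζ|_disc` is within `ε − η` of a zero-free holomorphic `g`
  (`stub_recurrence_of_approximant`, landed: Voronin/Bagchi disc universality for the target `g`);
* its complement, the ROUCHÉ regime, which forces an interior zero
  (`stub_approximant_of_noInteriorZero`, landed: the radial contraction of `ζ` is an approximant
  when the open disc is zero-free) — the open stub `stub_roucheRegime`.

This file records, sorry-free:
* `zetaWeakRecurrence_iff_roucheRegime` — the reshape is LOSSLESS: WR ⟺ `stub_roucheRegime`'s
  statement (so the open stub has exactly crux strength; nothing was given away);
* `exists_zero_of_return_of_noApproximant` — WHY "Rouché regime": in it, every `ε`-return `τ`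
  puts a zero of `ζ` in the shifted OPEN disc `|s − (z + iτ)| < r` (if not, the landed contraction
  stub at the shifted centre plus the triangle inequality builds a forbidden approximant);
* `not_exists_interiorZero_of_riemannHypothesis` — under RH the regime is EMPTY (calibration: the
  open stub is RH-implied, vacuously);
* `zeros_recur_of_zetaWeakRecurrence` — the zero-side shadow of WR: every zero `ξ` with
  `1/2 < Re ξ < 1` recurs, for every `δ > 0`, as zeros `ρ` with `|Re ρ − Re ξ| < δ` above every
  height (isolation + Rouché, Steuding Thm. 8.3 eq. (8.5));
* `exactFirstBand_of_cofinite_of_zetaWeakRecurrence`, `cofinite_of_asymptotic_of_zetaWeakRecurrence`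
  — WR ALONE implies both open glue rungs of the route (`CofiniteToExact`,
  stmt-RiemannHypothesis-14746, Bombieri's zero-or-infinity dichotomy; `AsymptoticToCofinite`,
  stmt-RiemannHypothesis-14745; both stated UNFOLDED so that no audit mistakes these conditional
  statements for proofs of those items), through the landed glue `NribWeakRecurrenceToExact` and
  the ladder.
-/

-- D-0017: single-problem summit; the lakefile turns this linter off for `Summits`; repeated here so that
-- standalone elaboration is warning-free as well.
set_option linter.dupNamespace false

noncomputable section

open Complex Set Metric Filter Topology

namespace Summit.RiemannHypothesis.RiemannHypothesis.Theorems.RuelleBandZetaWeakRecurrence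

open Summit.RiemannHypothesis.RiemannHypothesis.Theses.RuelleBand
open Literature.Barriers.RiemannHypothesis (exists_zero_near_shift)
open Summit.RiemannHypothesis.RiemannHypothesis.Theorems.NribWeakRecurrenceToExact
  (exists_punctured_ball_zeta_ne_zero exactFirstBand_of_noRightInteriorBand_of_weakRecurrence)
open Summit.RiemannHypothesis.RiemannHypothesis.Theorems.AsymptoticCriticalLine.InteriorEdgeSplit
  (noRightInteriorBand_of_asymptoticCriticalLine)

/-! ## 1. The reshape is lossless -/

/-- **WR ⟺ the Rouché-regime stub.** `→`: drop the two extra hypotheses. `←`: the registered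
composition — split on the existence of a zero-free holomorphic `(ε − η)`-approximant; if one
exists, `stub_recurrence_of_approximant`; if not, `stub_approximant_of_noInteriorZero`
(contrapositive) yields an interior zero and the Rouché-regime statement applies. -/
theorem zetaWeakRecurrence_iff_roucheRegime :
    ZetaWeakRecurrence ↔
      ∀ (z : ℂ) (r : ℝ), 0 < r → r < min (z.re - 1 / 2) (1 - z.re) →
        (∃ ξ ∈ Metric.ball z r, riemannZeta ξ = 0) → ∀ ε : ℝ, 0 < ε →
        (¬ ∃ (R η : ℝ) (g : ℂ → ℂ), r < R ∧ 0 < η ∧ DifferentiableOn ℂ g (Metric.ball z R) ∧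
          (∀ s ∈ Metric.closedBall z r, g s ≠ 0) ∧
          ∀ s ∈ Metric.closedBall z r, ‖riemannZeta s - g s‖ ≤ ε - η) →
        ∀ T : ℝ, ∃ τ : ℝ, T ≤ τ ∧
          ∀ s ∈ Metric.closedBall z r, ‖riemannZeta (s + ↑τ * Complex.I) - riemannZeta s‖ < ε := by
  constructor
  · intro h z r hr hrmin _ ε hε _ T
    exact h z r hr hrmin ε hε T
  · intro h3 z r hr hrmin ε hε T
    by_cases hA : ∃ (R η : ℝ) (g : ℂ → ℂ), r < R ∧ 0 < η ∧ DifferentiableOn ℂ g (Metric.ball z R) ∧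
        (∀ s ∈ Metric.closedBall z r, g s ≠ 0) ∧
        ∀ s ∈ Metric.closedBall z r, ‖riemannZeta s - g s‖ ≤ ε - η
    · exact stub_recurrence_of_approximant z r hr hrmin ε hε hA T
    · have hξ : ∃ ξ ∈ Metric.ball z r, riemannZeta ξ = 0 := by
        by_contra hno
        push Not at hno
        exact hA (stub_approximant_of_noInteriorZero z r hr hrmin hno ε hε)
      exact h3 z r hr hrmin hξ ε hε hA T

/-! ## 2. In the Rouché regime every return generates a zero -/

/-- Translating a closed disc vertically: `s ∈ closedBall z r ↔ s + iτ ∈ closedBall (z + iτ) r`. -/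
theorem add_mul_I_mem_closedBall_iff {z s : ℂ} {r : ℝ} (τ : ℝ) :
    s + τ * I ∈ Metric.closedBall (z + τ * I) r ↔ s ∈ Metric.closedBall z r := by
  rw [mem_closedBall, mem_closedBall, dist_eq_norm, dist_eq_norm, add_sub_add_right_eq_sub]

/-- Translating an open disc vertically: `s + iτ ∈ ball (z + iτ) R ↔ s ∈ ball z R`. -/
theorem add_mul_I_mem_ball_iff {z s : ℂ} {R : ℝ} (τ : ℝ) :
    s + τ * I ∈ Metric.ball (z + τ * I) R ↔ s ∈ Metric.ball z R := by
  rw [mem_ball, mem_ball, dist_eq_norm, dist_eq_norm, add_sub_add_right_eq_sub]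

/-- **Returns generate zeros in the Rouché regime.** If the closed disc `|s − z| ≤ r` of the
half-strip admits NO zero-free holomorphic approximant of `ζ` within `ε − η` (any `η > 0`, any
larger disc of holomorphy), then every shift `τ` with `max_{|s−z|≤r} |ζ(s+iτ) − ζ(s)| < ε` puts a
zero of `ζ` in the shifted OPEN disc: `ζ(ρ + iτ) = 0` for some `|ρ − z| < r`. Otherwise `ζ(·+iτ)`
is zero-free on the open disc about `z + iτ`; the landed contraction stub there, at level
`ε − max_{|s−z|≤r} |ζ(s+iτ) − ζ(s)| > 0`, gives a zero-free holomorphic `g`, and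
`s ↦ g(s + iτ)` is a forbidden approximant of `ζ` on the original disc (triangle inequality). -/
theorem exists_zero_of_return_of_noApproximant {z : ℂ} {r : ℝ} (hr : 0 < r)
    (hrmin : r < min (z.re - 1 / 2) (1 - z.re)) {ε : ℝ}
    (hA : ¬ ∃ (R η : ℝ) (g : ℂ → ℂ), r < R ∧ 0 < η ∧ DifferentiableOn ℂ g (Metric.ball z R) ∧
          (∀ s ∈ Metric.closedBall z r, g s ≠ 0) ∧
          ∀ s ∈ Metric.closedBall z r, ‖riemannZeta s - g s‖ ≤ ε - η)
    {τ : ℝ} (hτ : ∀ s ∈ Metric.closedBall z r, ‖riemannZeta (s + τ * I) - riemannZeta s‖ < ε) :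
    ∃ ρ ∈ Metric.ball z r, riemannZeta (ρ + τ * I) = 0 := by
  by_contra hno
  push Not at hno
  apply hA
  have hr2 : r < 1 - z.re := hrmin.trans_le (min_le_right _ _)
  have hr2' : r < 1 - (z + τ * I).re := by simpa using hr2
  -- (a) the maximal deviation `m < ε` on the compact disc
  have hmaps : MapsTo (fun s : ℂ => s + τ * I) (Metric.closedBall z r)
      (Metric.closedBall (z + τ * I) r) := fun s hs => (add_mul_I_mem_closedBall_iff τ).2 hs
  have hcont : ContinuousOn (fun s => ‖riemannZeta (s + τ * I) - riemannZeta s‖)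
      (Metric.closedBall z r) :=
    (((continuousOn_riemannZeta_closedBall hr2').comp (continuousOn_id.add continuousOn_const)
      hmaps).sub (continuousOn_riemannZeta_closedBall hr2)).norm
  obtain ⟨s₀, hs₀, hmax⟩ := (isCompact_closedBall z r).exists_isMaxOn
    ((nonempty_closedBall (x := z)).2 hr.le) hcont
  have hmε : ‖riemannZeta (s₀ + τ * I) - riemannZeta s₀‖ < ε := hτ s₀ hs₀
  -- (b) the contraction stub at the shifted centre, level `ε − m`
  have hrmin' : r < min ((z + τ * I).re - 1 / 2) (1 - (z + τ * I).re) := by simpa using hrmin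
  have hZ' : ∀ s ∈ Metric.ball (z + τ * I) r, riemannZeta s ≠ 0 := by
    intro s hs
    have hmem : s - τ * I ∈ Metric.ball z r := by
      rw [← add_mul_I_mem_ball_iff τ, sub_add_cancel]; exact hs
    simpa using hno (s - τ * I) hmem
  obtain ⟨R, η, g, hrR, hη, hg, hg0, happrox⟩ :=
    stub_approximant_of_noInteriorZero (z + τ * I) r hr hrmin' hZ'
      (ε - ‖riemannZeta (s₀ + τ * I) - riemannZeta s₀‖) (by linarith)
  -- (c) pull `g` back along the shift: a forbidden approximant on the original disc
  refine ⟨R, η, fun s => g (s + τ * I), hrR, hη, ?_, ?_, ?_⟩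
  · intro s hs
    have hs' : s + τ * I ∈ Metric.ball (z + τ * I) R := (add_mul_I_mem_ball_iff τ).2 hs
    exact (((hg _ hs').differentiableAt (isOpen_ball.mem_nhds hs')).comp s
      (differentiableAt_id.add_const _)).differentiableWithinAt
  · intro s hs
    exact hg0 _ ((add_mul_I_mem_closedBall_iff τ).2 hs)
  · intro s hs
    have h1 : ‖riemannZeta s - riemannZeta (s + τ * I)‖ ≤
        ‖riemannZeta (s₀ + τ * I) - riemannZeta s₀‖ := by
      rw [norm_sub_rev]; exact hmax hs
    have h2 := happrox _ ((add_mul_I_mem_closedBall_iff τ).2 hs)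
    calc ‖riemannZeta s - g (s + τ * I)‖
        ≤ ‖riemannZeta s - riemannZeta (s + τ * I)‖ +
            ‖riemannZeta (s + τ * I) - g (s + τ * I)‖ := norm_sub_le_norm_sub_add_norm_sub _ _ _
      _ ≤ ‖riemannZeta (s₀ + τ * I) - riemannZeta s₀‖ +
            (ε - ‖riemannZeta (s₀ + τ * I) - riemannZeta s₀‖ - η) := add_le_add h1 h2
      _ = ε - η := by ring

/-! ## 3. Calibration: the regime is empty under RH -/

/-- A point of the open disc `|s − z| < r`, `r < min (Re z − 1/2, 1 − Re z)`, lies in the open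
right half-strip `1/2 < Re s < 1`. -/
theorem re_mem_Ioo_of_mem_ball {z ξ : ℂ} {r : ℝ} (hrmin : r < min (z.re - 1 / 2) (1 - z.re))
    (hξ : ξ ∈ Metric.ball z r) : 1 / 2 < ξ.re ∧ ξ.re < 1 := by
  rw [mem_ball, dist_eq_norm] at hξ
  have h := (abs_re_le_norm (ξ - z)).trans hξ.le
  rw [sub_re, abs_le] at h
  have hr1 : r < z.re - 1 / 2 := hrmin.trans_le (min_le_left _ _)
  have hr2 : r < 1 - z.re := hrmin.trans_le (min_le_right _ _)
  exact ⟨by linarith [h.1], by linarith [h.2]⟩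

/-- **Under RH the Rouché regime is empty**: no disc of the half-strip carries an interior zero,
so the open stub `stub_roucheRegime` holds vacuously under RH (it is RH-implied). -/
theorem not_exists_interiorZero_of_riemannHypothesis (hRH : RiemannHypothesis) {z : ℂ} {r : ℝ}
    (hrmin : r < min (z.re - 1 / 2) (1 - z.re)) :
    ¬ ∃ ξ ∈ Metric.ball z r, riemannZeta ξ = 0 := by
  rintro ⟨ξ, hξ, hξ0⟩
  obtain ⟨h1, h2⟩ := re_mem_Ioo_of_mem_ball hrmin hξ
  have hnt : ¬ ∃ n : ℕ, ξ = -2 * (n + 1) := by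
    rintro ⟨n, hn⟩
    have := congrArg Complex.re hn
    simp at this
    linarith [(n.cast_nonneg : (0 : ℝ) ≤ n)]
  have hne1 : ξ ≠ 1 := by
    intro h; rw [h, one_re] at h2; exact lt_irrefl _ h2
  have := hRH ξ hξ0 hnt hne1
  linarith

/-! ## 4. The zero-side shadow of WR: zeros recur at infinite height -/

/-- **WR ⟹ zeros recur.** If `ζ` is weakly shift-recurrent on the discs of the half-strip, then
every zero `ξ` with `1/2 < Re ξ < 1` recurs near its abscissa above every height: for every
`δ > 0` and `T` there is a zero `ρ` with `|Re ρ − Re ξ| < δ` and `Im ρ > T`. (`ξ` is isolated;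
with `d < δ` inside the isolation radius and the half-strip and `ε := min_{|w−ξ|=d} |ζ(w)| > 0`, a
return `τ ≥ T − Im ξ + d + 1` on the disc `|s − ξ| ≤ d` generates by Rouché a zero within `d` of
`ξ + iτ`.) [cite: Steuding2007, Thm. 8.3 (proof; eq. 8.5)] -/
theorem zeros_recur_of_zetaWeakRecurrence (hW : ZetaWeakRecurrence) {ξ : ℂ}
    (hξ0 : riemannZeta ξ = 0) (hξhalf : 1 / 2 < ξ.re) (hξ1 : ξ.re < 1) {δ : ℝ} (hδ : 0 < δ)
    (T : ℝ) : ∃ ρ : ℂ, riemannZeta ρ = 0 ∧ |ρ.re - ξ.re| < δ ∧ T < ρ.im := by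
  -- `ξ` is an isolated zero
  have hξne1 : ξ ≠ 1 := by
    intro h; rw [h, one_re] at hξ1; exact lt_irrefl _ hξ1
  obtain ⟨δ₁, hδ₁, hpunct⟩ := exists_punctured_ball_zeta_ne_zero hξne1
  -- a radius `d` inside the punctured disc, inside the half-strip, below `δ`
  set m : ℝ := min (ξ.re - 1 / 2) (1 - ξ.re) with hmdef
  have hmpos : 0 < m := lt_min (by linarith) (by linarith)
  set d : ℝ := min (min (δ₁ / 2) (m / 2)) (δ / 2) with hddef
  have hdpos : 0 < d := lt_min (lt_min (by linarith) (by linarith)) (by linarith)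
  have hdδ₁ : d < δ₁ := ((min_le_left _ _).trans (min_le_left _ _)).trans_lt (by linarith)
  have hdm : d < m := ((min_le_left _ _).trans (min_le_right _ _)).trans_lt (by linarith)
  have hdδ : d < δ := (min_le_right _ _).trans_lt (by linarith)
  have hdone : d < 1 - ξ.re := hdm.trans_le (min_le_right _ _)
  -- `ε := min_{|w−ξ|=d} |ζ(w)| > 0`
  have hcont : ContinuousOn (fun w ↦ ‖riemannZeta w‖) (sphere ξ d) := by
    refine ContinuousOn.norm fun w hw ↦ ?_
    have hw1 : w ≠ 1 := by
      intro h
      rw [h, mem_sphere, dist_eq_norm] at hw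
      have := abs_re_le_norm (1 - ξ)
      rw [hw, sub_re, one_re] at this
      rw [abs_le] at this
      linarith [this.1]
    exact (differentiableAt_riemannZeta hw1).continuousAt.continuousWithinAt
  obtain ⟨w₀, hw₀, hmin⟩ := (isCompact_sphere ξ d).exists_isMinOn
    (NormedSpace.sphere_nonempty.2 hdpos.le) hcont
  set ε : ℝ := ‖riemannZeta w₀‖ with hεdef
  have hεpos : 0 < ε := by
    rw [hεdef, norm_pos_iff]
    refine hpunct w₀ ?_ ?_
    · rw [mem_sphere.1 hw₀]; exact hdδ₁
    · intro h
      have := mem_sphere.1 hw₀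
      rw [h, dist_self] at this
      exact hdpos.ne this
  have hεle : ∀ w ∈ sphere ξ d, ε ≤ ‖riemannZeta w‖ := fun w hw ↦ hmin hw
  -- a late return and the zero it generates
  obtain ⟨τ, hτT, hτ⟩ := hW ξ d hdpos hdm ε hεpos (T - ξ.im + d + 1)
  obtain ⟨ρ, hρ0, hρdist⟩ := exists_zero_near_shift hξ0 hdpos (by linarith) hεle hτ
  refine ⟨ρ, hρ0, ?_, ?_⟩
  · rw [dist_eq_norm] at hρdist
    have h := abs_re_le_norm (ρ - (ξ + τ * I))
    have h' : (ρ - (ξ + τ * I)).re = ρ.re - ξ.re := by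
      simp only [sub_re, add_re, mul_re, ofReal_re, ofReal_im, I_re, I_im]; ring
    rw [h'] at h
    exact (h.trans_lt hρdist).trans hdδ
  · rw [dist_eq_norm] at hρdist
    have h := abs_im_le_norm (ρ - (ξ + τ * I))
    have h' : (ρ - (ξ + τ * I)).im = ρ.im - (ξ.im + τ) := by
      simp only [sub_im, add_im, mul_im, ofReal_re, ofReal_im, I_re, I_im]; ring
    rw [h'] at h
    have him := h.trans_lt hρdist
    rw [abs_lt] at him
    linarith [him.1]

/-! ## 5. WR alone implies both open glue rungs of the route -/

/-- **WR ⟹ the rung `CofiniteToExact`** (stmt-RiemannHypothesis-14746, stated unfolded: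
`CofiniteCriticalLine → ExactFirstBand`; Bombieri's zero-or-infinity dichotomy "finitely many
off-line zeros ⟹ none"): a finite off-line set gives `AsymptoticCriticalLine` (ladder), hence no
right-interior band, and the landed glue `NoRightInteriorBand → ZetaWeakRecurrence → ExactFirstBand`
concludes. So the crux is at least as strong as this open rung; this is a CONDITIONAL statement and
closes nothing. [cite: Steuding2007, Thm. 8.3 (proof)] -/
theorem exactFirstBand_of_cofinite_of_zetaWeakRecurrence (hW : ZetaWeakRecurrence)
    (hC : CofiniteCriticalLine) : ExactFirstBand :=
  exactFirstBand_of_noRightInteriorBand_of_weakRecurrence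
    (noRightInteriorBand_of_asymptoticCriticalLine
      (ruelleBand_asymptoticCriticalLine_of_cofiniteCriticalLine hC)) hW

/-- **WR ⟹ the rung `AsymptoticToCofinite`** (stmt-RiemannHypothesis-14745, stated unfolded:
`AsymptoticCriticalLine → CofiniteCriticalLine`): under `AsymptoticCriticalLine` there is no
right-interior band, WR then gives `ExactFirstBand`, and `ExactFirstBand → CofiniteCriticalLine` is
the ladder. CONDITIONAL; closes nothing. [cite: Steuding2007, Thm. 8.3 (proof)] -/
theorem cofinite_of_asymptotic_of_zetaWeakRecurrence (hW : ZetaWeakRecurrence)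
    (hA : AsymptoticCriticalLine) : CofiniteCriticalLine :=
  ruelleBand_cofiniteCriticalLine_of_exactFirstBand
    (exactFirstBand_of_noRightInteriorBand_of_weakRecurrence
      (noRightInteriorBand_of_asymptoticCriticalLine hA) hW)

end Summit.RiemannHypothesis.RiemannHypothesis.Theorems.RuelleBandZetaWeakRecurrence

end
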